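import Mathlib.LinearAlgebra.Matrix.PosDef
import Mathlib.LinearAlgebra.Matrix.NonsingularInverse
import Mathlib.Analysis.Complex.Basic
import HarnessLib

/-!
# Venture HSemireg — the POLARISED RANGE of (S3)'s secant exponent is invariant under the unitary group of the
# hyperbolic Hermitian form: `Im Z > 0 ⇒ Im (C + DZ)(A + BZ)⁻¹ > 0` (Hermitian upper half-space of type `I_{n,n}`) —
# TRACK S4-PUSH (ii), seat `s4-prove-1` (g10); file IX of the lane; file of record `s4push/prove-1/ATTEMPT-12.md`

HONEST FRAMING. Lean index of the computation cell `pub-hsemireg`. MATRICES ONLY (Mathlib `Matrix.PosDef` over `ℂ` with its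
`ComplexOrder`): no abelian variety, sheaf, derived category, spinor or autoequivalence is constructed here. The dictionary
«secant exponent `B = a + √-d·b` of type `(1,1)` ↦ complex matrix `Z = H_a + i√d·H_b` (Lange's Hermitian forms in a complex basis,
`Im Z := (Z - Zᴴ)/2i = √d·H_b`); an autoequivalence `Φ ∈ Aut D^b(X)` acts on `H^*(X, ℚ)` through `Spin_{Hdg}(V)`, `V = H¹(X) ⊕ H¹(X̂)`
[GolyshevLuntsOrlov2001MirrorAV; Orlov2002DerivedAbelian; Markman2025SecantWeil §5], i.e. through a Hodge isometry of `V`, which on the `+i`-part of `V_ℂ` is a complex `2n × 2n` matrix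
`g = (A B; C D)` preserving the hyperbolic Hermitian form `h = (0 -i; i 0)`; the maximal isotropic subspace of the pure spinor `e^B` is a
graph and `g` moves it to the graph of `(C + DZ)(A + BZ)⁻¹` [Chevalley; Mar25 §2.2; Satake App. §3 (I_{p,q})]» is PAPER (ATTEMPT-12 §1)
and is NOT formalised. Nothing here says that HC, HC_CM or HC_AV holds; nothing here is a new case of anything; (S3)'s STATUS WORD does
not move. NO definition, NO named fact: theorems only, all PROVED (0 sorry).

WHAT IT ADDS. File VIII (`SecantParityObjectLevelEffectiveCycles`, p373968) proved that THE secant direction `b` of a CYCLE-TYPE secant sheaf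
is `±` a polarisation, i.e. `±Im Z` positive definite. The (S5)-open corner of the census lists «autoequivalence orbits» as a mechanism for new
objects; this file is the linear algebra saying that the polarised range is an INVARIANT of such orbits: with `Im Z := i(Zᴴ - Z)/2`,
* `conjTranspose_mul_sub_eq_smul` — the KEY IDENTITY: if `AᴴC = CᴴA`, `BᴴD = DᴴB` and `AᴴD - CᴴB = s·1` (`s` real; `s = 1`: `g` preserves
  `h`; `s = -1`: `g` reverses it, e.g. dualisation) then `(C + DZ)ᴴ(A + BZ) - (A + BZ)ᴴ(C + DZ) = s·(Zᴴ - Z)` for EVERY `Z`;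
* `isUnit_add_mul_of_posDef_im` — if moreover `s ≠ 0` and `i(Zᴴ - Z)` is positive definite then `A + BZ` is invertible (a vector killed by
  `A + BZ` is `h`-isotropic on the positive graph of `Z`) — the image pure spinor has non-zero rank part;
* **`posDef_smul_im_moebius`** — and `s · i(Z'ᴴ - Z')` is positive definite for `Z' = (C + DZ)(A + BZ)⁻¹`: the sign of `Im` is carried
  along (`s = 1`) or reversed (`s = -1`), never lost: `Im Z' = (A + BZ)⁻ᴴ · s·Im Z · (A + BZ)⁻¹`;
* §5 NUMBERS for the Fourier–Mukai move (`posDef_im_neg_inv_formula`): for `Z = H_a + iH_c`, `Im(-Z⁻¹) = (H_c + H_aH_c⁻¹H_a)⁻¹` explicitly;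
* the three generators and the mirror: `posDef_im_add_of_isHermitian` (twist by a line bundle: `Z ↦ S + Z`, `S` Hermitian),
  `posDef_im_conjTranspose_mul_mul` (automorphism / isogeny: `Z ↦ QᴴZQ`), **`posDef_im_neg_inv`** (Fourier–Mukai / Poincaré: `Z ↦ -Z⁻¹`,
  Mukai's `e^B ↦ e^{-B⁻¹}` up to a scalar), and `negDef` versions (`-Im Z > 0` is carried the same way).
Read with file VIII: along the `Aut D^b(X)`-orbit of a cycle-type secant object the secant direction stays `±` a polarisation, so (H1) holds
there too and an odd-index direction cannot be reached from a cycle-type object by autoequivalences (ATTEMPT-12 §3; sheet S3INP-13).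

Statements and proofs: s4-prove-1 g10 (2026-08-24); reads invited: s4-ref (statement read; the dictionary of ATTEMPT-12 §1), lit-w-markman
(Mar25 §5 / [GLO] as printed), s4-prove-3 (×2).

## References

* [Satake1980AlgebraicStructures] I. Satake, Algebraic Structures of Symmetric Domains (1980), Appendix §3, the case `(I_{p,q})`, eqs. (3.15)–(3.19)
  («`ᵗZ̄₂Z₂ ≫ 0` and so `Z₂` is non-singular»; `g(Z) = (AZ + B)(CZ + D)⁻¹`; `gV₋(Z) = V₋(g(Z))`) — the bounded twin of the argument here.
* [Markman2025SecantWeil] E. Markman, arXiv:2502.03415, §5 eq. (the sequence `0 → 2ℤ × X × X̂ → Aut(D^b(X)) → Spin_{Hdg}(V_X) → 0`,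
  [golyshev-luntz-orlov]) and §2.2 (pure spinors ↔ maximal isotropic subspaces, [chevalley]) — dictionary only.
* [Mukai1981] S. Mukai, Duality between `D(X)` and `D(X̂)` with its application to Picard sheaves, Nagoya Math. J. 81 (1981), Thm. 2.2
  (duality) and Thm. 3.13 (the `SL(2,ℤ)`-action for a principal polarisation) — dictionary only (`Z ↦ -Z⁻¹`).
* [GolyshevLuntsOrlov2001MirrorAV] V. Golyshev, V. Lunts, D. Orlov, Mirror symmetry for abelian varieties, J. Algebraic Geom. 10 (2001);
  [Orlov2002DerivedAbelian] D. Orlov, Izv. Math. 66 (2002) — `Aut D^b(X) → Spin(V)` / `U(X × X̂)`, as reviewed in [Markman2025SecantWeil, §5]; dictionary only.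
* Cell records: STATEMENTS-S3INPUT.md S3INP-3, S3INP-12, S3INP-13; ATTEMPT-12.md; file VIII `SecantParityObjectLevelEffectiveCycles.lean`.
-/

namespace Summit.Ventures.HSemireg

namespace SecantParity

open scoped ComplexOrder Matrix
open Complex Matrix

variable {ι : Type*} [Fintype ι] [DecidableEq ι]

/-! ### §1 The key identity of the linear fractional action -/

/-- **KEY IDENTITY.** For complex square matrices with `AᴴC = CᴴA`, `BᴴD = DᴴB`, `AᴴD - CᴴB = s·1` (`s` real) — the block relations of
`gᴴ h g = s·h` for `g = (A B; C D)` and the hyperbolic Hermitian form `h = (0 -i; i 0)` — and every `Z`: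
`(C + DZ)ᴴ(A + BZ) - (A + BZ)ᴴ(C + DZ) = s·(Zᴴ - Z)`. [cite: Satake1980AlgebraicStructures, Appendix §3 (I_{p,q}) eqs. (3.18)–(3.19)] -/
theorem conjTranspose_mul_sub_eq_smul {A B C D Z : Matrix ι ι ℂ} {s : ℝ}
    (h1 : Aᴴ * C = Cᴴ * A) (h2 : Aᴴ * D - Cᴴ * B = (s : ℂ) • (1 : Matrix ι ι ℂ)) (h4 : Bᴴ * D = Dᴴ * B) :
    (C + D * Z)ᴴ * (A + B * Z) - (A + B * Z)ᴴ * (C + D * Z) = (s : ℂ) • (Zᴴ - Z) := by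
  -- the conjugate-transposed relation `DᴴA - BᴴC = s·1`
  have h3 : Dᴴ * A - Bᴴ * C = (s : ℂ) • (1 : Matrix ι ι ℂ) := by
    have h := congrArg conjTranspose h2
    rw [conjTranspose_sub, conjTranspose_mul, conjTranspose_mul, conjTranspose_conjTranspose,
      conjTranspose_conjTranspose, conjTranspose_smul, conjTranspose_one, Complex.star_def, Complex.conj_ofReal] at h
    exact h
  have e2 : Aᴴ * D = Cᴴ * B + (s : ℂ) • (1 : Matrix ι ι ℂ) := by rw [← h2]; abel
  have e3 : Dᴴ * A = Bᴴ * C + (s : ℂ) • (1 : Matrix ι ι ℂ) := by rw [← h3]; abel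
  -- expand and regroup
  have hL : (C + D * Z)ᴴ * (A + B * Z) - (A + B * Z)ᴴ * (C + D * Z) =
      (Cᴴ * A - Aᴴ * C) + (Cᴴ * B - Aᴴ * D) * Z + Zᴴ * (Dᴴ * A - Bᴴ * C) + Zᴴ * (Dᴴ * B - Bᴴ * D) * Z := by
    simp only [conjTranspose_add, conjTranspose_mul, add_mul, mul_add, sub_mul, mul_sub, Matrix.mul_assoc]
    abel
  rw [hL, h1, h4, sub_self, sub_self, zero_add, Matrix.mul_zero, Matrix.zero_mul, add_zero, h3, e2,
    show Cᴴ * B - (Cᴴ * B + (s : ℂ) • (1 : Matrix ι ι ℂ)) = -((s : ℂ) • (1 : Matrix ι ι ℂ)) by abel,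
    neg_mul, Matrix.smul_mul, Matrix.one_mul, Matrix.mul_smul, Matrix.mul_one, smul_sub]
  abel

/-! ### §2 Invertibility of `A + BZ` and positivity of `Im (C + DZ)(A + BZ)⁻¹` -/

omit [DecidableEq ι] in
/-- The quadratic form of `Mᴴ N - Nᴴ M` at `v` only sees `M v` and `N v`: `v̄·(MᴴN - NᴴM)v = (Mv)‾·(Nv) - (Nv)‾·(Mv)`. [folklore] -/
theorem star_dotProduct_conjTranspose_mul_sub_mulVec (M N : Matrix ι ι ℂ) (v : ι → ℂ) :
    star v ⬝ᵥ ((Mᴴ * N - Nᴴ * M) *ᵥ v) = star (M *ᵥ v) ⬝ᵥ (N *ᵥ v) - star (N *ᵥ v) ⬝ᵥ (M *ᵥ v) := by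
  rw [star_mulVec, star_mulVec, ← dotProduct_mulVec, ← dotProduct_mulVec, mulVec_mulVec, mulVec_mulVec,
    ← dotProduct_sub, ← sub_mulVec]

omit [DecidableEq ι] in
/-- On a vector `v` the form `v̄·(Zᴴ - Z)v` is recovered from `i(Zᴴ - Z)`: positivity of the latter makes the former non-zero.
[cite: Satake1980AlgebraicStructures, Appendix §3 (I_{p,q}) eq. (3.15)] -/
theorem star_dotProduct_mulVec_ne_zero_of_posDef_im {Z : Matrix ι ι ℂ} (hZ : (I • (Zᴴ - Z)).PosDef) {v : ι → ℂ} (hv : v ≠ 0) :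
    star v ⬝ᵥ ((Zᴴ - Z) *ᵥ v) ≠ 0 := by
  intro h0
  have hpos := hZ.dotProduct_mulVec_pos hv
  rw [smul_mulVec, dotProduct_smul, h0, smul_zero] at hpos
  exact lt_irrefl _ hpos

/-- **`A + BZ` is invertible** when `(C + DZ)ᴴ(A + BZ) - (A + BZ)ᴴ(C + DZ) = s·(Zᴴ - Z)` with `s ≠ 0` and `i(Zᴴ - Z)` positive definite:
a vector `v` with `(A + BZ)v = 0` gives `s·v̄(Zᴴ - Z)v = 0`, so `v = 0` — the image of the positive graph of `Z` is again a graph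
(Satake: «`ᵗZ̄₂Z₂ ≫ 0` and so `Z₂` is non-singular»). [cite: Satake1980AlgebraicStructures, Appendix §3 (I_{p,q}) eqs. (3.15)–(3.17)] -/
theorem isUnit_add_mul_of_posDef_im {A B C D Z : Matrix ι ι ℂ} {s : ℝ} (hs : s ≠ 0)
    (hM : (C + D * Z)ᴴ * (A + B * Z) - (A + B * Z)ᴴ * (C + D * Z) = (s : ℂ) • (Zᴴ - Z))
    (hZ : (I • (Zᴴ - Z)).PosDef) : IsUnit (A + B * Z) := by
  rw [← mulVec_injective_iff_isUnit]
  -- injectivity from the trivial kernel of the linear map `v ↦ (A + BZ) v`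
  intro v w hvw
  rw [← sub_eq_zero]
  by_contra hne
  have hker : (A + B * Z) *ᵥ (v - w) = 0 := by rw [mulVec_sub, hvw, sub_self]
  have hq := star_dotProduct_conjTranspose_mul_sub_mulVec (C + D * Z) (A + B * Z) (v - w)
  rw [hM, hker, dotProduct_zero, star_zero, zero_dotProduct, sub_zero, smul_mulVec, dotProduct_smul,
    smul_eq_mul] at hq
  -- `s · (v-w)‾(Zᴴ - Z)(v-w) = 0` with `s ≠ 0`
  rcases mul_eq_zero.1 hq with hs0 | h0
  · exact hs (by exact_mod_cast hs0)
  · exact star_dotProduct_mulVec_ne_zero_of_posDef_im hZ hne h0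

/-- Transport of the imaginary part: with `P = A + BZ` invertible and `Z' = (C + DZ)P⁻¹`, the key identity reads
`Pᴴ (Z'ᴴ - Z') P = s·(Zᴴ - Z)`. [cite: Satake1980AlgebraicStructures, Appendix §3 (I_{p,q}) eq. (3.19)] -/
theorem conjTranspose_mul_im_moebius_mul {A B C D Z : Matrix ι ι ℂ} {s : ℝ}
    (hM : (C + D * Z)ᴴ * (A + B * Z) - (A + B * Z)ᴴ * (C + D * Z) = (s : ℂ) • (Zᴴ - Z)) (hP : IsUnit (A + B * Z)) :
    (A + B * Z)ᴴ * (((C + D * Z) * (A + B * Z)⁻¹)ᴴ - (C + D * Z) * (A + B * Z)⁻¹) * (A + B * Z) = (s : ℂ) • (Zᴴ - Z) := by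
  set P := A + B * Z with hPdef
  set Q := C + D * Z with hQdef
  have hdet : IsUnit P.det := (isUnit_iff_isUnit_det P).1 hP
  have t1 : Pᴴ * (Q * P⁻¹)ᴴ * P = Qᴴ * P := by
    rw [conjTranspose_mul, ← Matrix.mul_assoc, ← conjTranspose_mul, nonsing_inv_mul P hdet, conjTranspose_one,
      Matrix.one_mul]
  have t2 : Pᴴ * (Q * P⁻¹) * P = Pᴴ * Q := by
    rw [Matrix.mul_assoc, Matrix.mul_assoc, nonsing_inv_mul P hdet, Matrix.mul_one]
  rw [Matrix.mul_sub, Matrix.sub_mul, t1, t2]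
  exact hM

/-- **MAIN THEOREM — the Hermitian upper half-space is carried to itself (or to its mirror) by the linear fractional action.**
For `g = (A B; C D)` with `AᴴC = CᴴA`, `BᴴD = DᴴB`, `AᴴD - CᴴB = s·1` (`s ≠ 0` real) and `Z` with `i(Zᴴ - Z)` positive definite
(`Im Z > 0`): `A + BZ` is invertible and, for `Z' = (C + DZ)(A + BZ)⁻¹`, the matrix `s·i(Z'ᴴ - Z')` is positive definite — `Im Z'` is
definite with the sign of `s` (`Im Z' = P⁻ᴴ (s·Im Z) P⁻¹`). Satake's `(I_{p,q})` argument in the unbounded realisation, for `U(n,n)`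
(`s = 1`) and its form-reversing coset (`s = -1`). [cite: Satake1980AlgebraicStructures, Appendix §3 (I_{p,q}) eqs. (3.15)–(3.19)] -/
theorem posDef_smul_im_moebius {A B C D Z : Matrix ι ι ℂ} {s : ℝ} (hs : s ≠ 0)
    (h1 : Aᴴ * C = Cᴴ * A) (h2 : Aᴴ * D - Cᴴ * B = (s : ℂ) • (1 : Matrix ι ι ℂ)) (h4 : Bᴴ * D = Dᴴ * B)
    (hZ : (I • (Zᴴ - Z)).PosDef) :
    IsUnit (A + B * Z) ∧
      ((s : ℂ) • (I • (((C + D * Z) * (A + B * Z)⁻¹)ᴴ - (C + D * Z) * (A + B * Z)⁻¹))).PosDef := by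
  have hM := conjTranspose_mul_sub_eq_smul (Z := Z) h1 h2 h4
  have hP := isUnit_add_mul_of_posDef_im hs hM hZ
  refine ⟨hP, ?_⟩
  set P := A + B * Z with hPdef
  set Z' := (C + D * Z) * P⁻¹ with hZ'def
  have hdet : IsUnit P.det := (isUnit_iff_isUnit_det P).1 hP
  have hPinv : IsUnit P⁻¹ := by
    rw [isUnit_iff_isUnit_det]
    exact (isUnit_nonsing_inv_det_iff (A := P)).2 hdet
  -- `Z'ᴴ - Z' = P⁻ᴴ (s • (Zᴴ - Z)) P⁻¹`
  have hkey := conjTranspose_mul_im_moebius_mul hM hP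
  have hconj : Z'ᴴ - Z' = (P⁻¹)ᴴ * ((s : ℂ) • (Zᴴ - Z)) * P⁻¹ := by
    rw [← hkey]
    have u1 : (P⁻¹)ᴴ * Pᴴ = 1 := by rw [← conjTranspose_mul, mul_nonsing_inv P hdet, conjTranspose_one]
    have u2 : P * P⁻¹ = 1 := mul_nonsing_inv P hdet
    calc Z'ᴴ - Z' = ((P⁻¹)ᴴ * Pᴴ) * (Z'ᴴ - Z') * (P * P⁻¹) := by rw [u1, u2, Matrix.one_mul, Matrix.mul_one]
      _ = (P⁻¹)ᴴ * (Pᴴ * (Z'ᴴ - Z') * P) * P⁻¹ := by simp only [Matrix.mul_assoc]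
  -- `s • I • (Z'ᴴ - Z') = P⁻ᴴ (s² • I • (Zᴴ - Z)) P⁻¹`, a congruence of a positive definite matrix
  have hsq : (s : ℂ) • (I • (Z'ᴴ - Z')) = (P⁻¹)ᴴ * (((s * s : ℝ) : ℂ) • (I • (Zᴴ - Z))) * P⁻¹ := by
    rw [hconj]
    simp only [Matrix.smul_mul, Matrix.mul_smul, smul_smul, Complex.ofReal_mul]
    congr 1
    ring
  rw [hsq]
  refine PosDef.conjTranspose_mul_mul_same ?_ (mulVec_injective_of_isUnit hPinv)
  -- `s² • (I • (Zᴴ - Z))` is positive definite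
  refine PosDef.of_dotProduct_mulVec_pos ?_ fun x hx ↦ ?_
  · have hH : (I • (Zᴴ - Z))ᴴ = I • (Zᴴ - Z) := hZ.isHermitian
    change (((s * s : ℝ) : ℂ) • (I • (Zᴴ - Z)))ᴴ = ((s * s : ℝ) : ℂ) • (I • (Zᴴ - Z))
    rw [conjTranspose_smul, hH, Complex.star_def, Complex.conj_ofReal]
  · rw [smul_mulVec, dotProduct_smul, smul_eq_mul]
    exact mul_pos (by exact_mod_cast mul_self_pos.2 hs) (hZ.dotProduct_mulVec_pos hx)

/-! ### §3 The unitary and the form-reversing cases; negative definite input -/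

/-- **`U(n,n)` preserves the Hermitian upper half-space**: `AᴴC = CᴴA`, `BᴴD = DᴴB`, `AᴴD - CᴴB = 1` and `Im Z > 0` ⇒ `A + BZ` invertible and
`Im (C + DZ)(A + BZ)⁻¹ > 0`. [cite: Satake1980AlgebraicStructures, Appendix §3 (I_{p,q}) eqs. (3.15)–(3.19)] -/
theorem posDef_im_moebius_of_unitary {A B C D Z : Matrix ι ι ℂ}
    (h1 : Aᴴ * C = Cᴴ * A) (h2 : Aᴴ * D - Cᴴ * B = 1) (h4 : Bᴴ * D = Dᴴ * B) (hZ : (I • (Zᴴ - Z)).PosDef) :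
    IsUnit (A + B * Z) ∧ (I • (((C + D * Z) * (A + B * Z)⁻¹)ᴴ - (C + D * Z) * (A + B * Z)⁻¹)).PosDef := by
  have h := posDef_smul_im_moebius (s := 1) (Z := Z) one_ne_zero h1 (by rw [h2, Complex.ofReal_one, one_smul]) h4 hZ
  rwa [Complex.ofReal_one, one_smul] at h

/-- **The form-reversing coset maps the upper to the LOWER half-space**: `AᴴD - CᴴB = -1` (e.g. composition with the sign involution
`τ` / dualisation) and `Im Z > 0` ⇒ `Im (C + DZ)(A + BZ)⁻¹ < 0` — definiteness is carried, only the sign flips.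
[cite: Satake1980AlgebraicStructures, Appendix §3 (I_{p,q}) eqs. (3.18)–(3.20)] -/
theorem negDef_im_moebius_of_antiunitary {A B C D Z : Matrix ι ι ℂ}
    (h1 : Aᴴ * C = Cᴴ * A) (h2 : Aᴴ * D - Cᴴ * B = -1) (h4 : Bᴴ * D = Dᴴ * B) (hZ : (I • (Zᴴ - Z)).PosDef) :
    IsUnit (A + B * Z) ∧ (-(I • (((C + D * Z) * (A + B * Z)⁻¹)ᴴ - (C + D * Z) * (A + B * Z)⁻¹))).PosDef := by
  have h := posDef_smul_im_moebius (s := -1) (Z := Z) (by norm_num) h1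
    (by rw [h2, Complex.ofReal_neg, Complex.ofReal_one, neg_smul, one_smul]) h4 hZ
  rwa [Complex.ofReal_neg, Complex.ofReal_one, neg_smul, one_smul] at h

/-- **Negative definite input** (`Im Z < 0`, i.e. the secant direction `b` with `-b` a polarisation): the same transport, read through
`(A, B, C, D, Z, s) ↦ (A, -B, C, -D, -Z, -s)`: `A + BZ` invertible and `-s · Im Z' > 0`. [cite: Satake1980AlgebraicStructures, Appendix §3 (I_{p,q}) and Exercise 1 (`I ↦ -I`)] -/
theorem posDef_neg_smul_im_moebius_of_negDef {A B C D Z : Matrix ι ι ℂ} {s : ℝ} (hs : s ≠ 0)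
    (h1 : Aᴴ * C = Cᴴ * A) (h2 : Aᴴ * D - Cᴴ * B = (s : ℂ) • (1 : Matrix ι ι ℂ)) (h4 : Bᴴ * D = Dᴴ * B)
    (hZ : (-(I • (Zᴴ - Z))).PosDef) :
    IsUnit (A + B * Z) ∧
      (-((s : ℂ) • (I • (((C + D * Z) * (A + B * Z)⁻¹)ᴴ - (C + D * Z) * (A + B * Z)⁻¹)))).PosDef := by
  have hZ' : (I • ((-Z)ᴴ - (-Z))).PosDef := by
    rwa [conjTranspose_neg, sub_neg_eq_add, neg_add_eq_sub, ← neg_sub, smul_neg]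
  have h2' : Aᴴ * (-D) - Cᴴ * (-B) = ((-s : ℝ) : ℂ) • (1 : Matrix ι ι ℂ) := by
    rw [Matrix.mul_neg, Matrix.mul_neg, sub_neg_eq_add, neg_add_eq_sub, ← neg_sub, h2, Complex.ofReal_neg, neg_smul]
  have h4' : (-B)ᴴ * (-D) = (-D)ᴴ * (-B) := by
    rw [conjTranspose_neg, conjTranspose_neg, neg_mul_neg, neg_mul_neg, h4]
  have h := posDef_smul_im_moebius (A := A) (B := -B) (C := C) (D := -D) (Z := -Z) (s := -s) (neg_ne_zero.2 hs)
    h1 h2' h4' hZ'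
  rw [neg_mul_neg, neg_mul_neg, Complex.ofReal_neg, neg_smul] at h
  exact h

/-! ### §4 The three generators of the dictionary: twist, automorphism, Fourier–Mukai -/

omit [Fintype ι] [DecidableEq ι] in
/-- **Twist by a line bundle** (`B ↦ B + c₁(M)`: `Z ↦ S + Z` with `S` Hermitian) does not touch `Im Z`.
[cite: Markman2025SecantWeil, §5 («the factor `X̂` … via tensorization by line bundles»)] -/
theorem posDef_im_add_of_isHermitian {S Z : Matrix ι ι ℂ} (hS : Sᴴ = S) (hZ : (I • (Zᴴ - Z)).PosDef) :
    (I • ((S + Z)ᴴ - (S + Z))).PosDef := by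
  rwa [conjTranspose_add, hS, add_sub_add_left_eq_sub]

/-- **Automorphism / isogeny of `X`** (`B ↦ f^*B`: `Z ↦ QᴴZQ` with `Q` invertible) carries `Im Z > 0` to `Im (QᴴZQ) = Qᴴ(Im Z)Q > 0`.
[cite: Satake1980AlgebraicStructures, Appendix §3 (I_{p,q}) eq. (3.19) with `B = C = 0`] -/
theorem posDef_im_conjTranspose_mul_mul {Q Z : Matrix ι ι ℂ} (hQ : IsUnit Q) (hZ : (I • (Zᴴ - Z)).PosDef) :
    (I • ((Qᴴ * Z * Q)ᴴ - Qᴴ * Z * Q)).PosDef := by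
  have h : I • ((Qᴴ * Z * Q)ᴴ - Qᴴ * Z * Q) = Qᴴ * (I • (Zᴴ - Z)) * Q := by
    rw [conjTranspose_mul, conjTranspose_mul, conjTranspose_conjTranspose, ← Matrix.mul_assoc, ← Matrix.sub_mul,
      ← Matrix.mul_sub, Matrix.mul_smul, Matrix.smul_mul]
  rw [h]
  exact hZ.conjTranspose_mul_mul_same (mulVec_injective_of_isUnit hQ)

/-- **Fourier–Mukai / Poincaré bundle** (Mukai: `e^B ↦ e^{-B⁻¹}` up to a scalar; here `g = (0 1; -1 0)`, `Z ↦ -Z⁻¹`): `Im Z > 0` ⇒ `Z`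
invertible and `Im (-Z⁻¹) > 0`. [cite: Mukai1981, Thm. 2.2 and Thm. 3.13] [cite: Satake1980AlgebraicStructures, Appendix §3 (I_{p,q}) eq. (3.19)] -/
theorem posDef_im_neg_inv {Z : Matrix ι ι ℂ} (hZ : (I • (Zᴴ - Z)).PosDef) :
    IsUnit Z ∧ (I • ((-Z⁻¹)ᴴ - (-Z⁻¹))).PosDef := by
  have h := posDef_im_moebius_of_unitary (A := 0) (B := 1) (C := -1) (D := 0) (Z := Z)
    (by rw [conjTranspose_zero, Matrix.zero_mul, Matrix.mul_zero])
    (by rw [conjTranspose_zero, Matrix.zero_mul, conjTranspose_neg, conjTranspose_one, Matrix.neg_mul, Matrix.one_mul,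
      zero_sub, neg_neg])
    (by rw [conjTranspose_one, Matrix.one_mul, conjTranspose_zero, Matrix.zero_mul]) hZ
  rwa [zero_add, Matrix.one_mul, Matrix.zero_mul, add_zero, Matrix.neg_mul, Matrix.one_mul] at h

/-- Composition: the transported `Z' = -Z⁻¹` may be twisted and conjugated again — the polarised range is stable under the group
generated by the three moves (e.g. `Im (S - Qᴴ Z⁻¹ Q) > 0`). [cite: Satake1980AlgebraicStructures, Appendix §3 (I_{p,q})] -/
theorem posDef_im_add_neg_conjTranspose_inv_mul {S Q Z : Matrix ι ι ℂ} (hS : Sᴴ = S) (hQ : IsUnit Q)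
    (hZ : (I • (Zᴴ - Z)).PosDef) : (I • ((S + Qᴴ * (-Z⁻¹) * Q)ᴴ - (S + Qᴴ * (-Z⁻¹) * Q))).PosDef :=
  posDef_im_add_of_isHermitian hS (posDef_im_conjTranspose_mul_mul hQ (posDef_im_neg_inv hZ).2)

/-! ### §5 Numbers for the Fourier–Mukai move: `Im(-(H_a + iH_c)⁻¹) = (H_c + H_a H_c⁻¹ H_a)⁻¹` -/

/-- **Explicit inverse**: for `H_a` Hermitian and `H_c` positive definite, `(H_a + iH_c)·[(H_c⁻¹H_a - i)(H_aH_c⁻¹H_a + H_c)⁻¹] = 1`.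
[cite: Satake1980AlgebraicStructures, Appendix §3 (I_{p,q}) eq. (3.19)] -/
theorem add_I_smul_mul_inv_formula_eq_one {Ha Hc : Matrix ι ι ℂ} (hHa : Haᴴ = Ha) (hHc : Hc.PosDef) :
    (Ha + I • Hc) * ((Hc⁻¹ * Ha - I • (1 : Matrix ι ι ℂ)) * (Ha * Hc⁻¹ * Ha + Hc)⁻¹) = 1 := by
  have hcU : IsUnit Hc.det := (isUnit_iff_isUnit_det Hc).1 hHc.isUnit
  -- `N = Ha Hc⁻¹ Ha + Hc` is positive definite, hence invertible
  have hN : (Ha * Hc⁻¹ * Ha + Hc).PosDef := by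
    have h1 : (Ha * Hc⁻¹ * Ha).PosSemidef := by
      have := hHc.inv.posSemidef.conjTranspose_mul_mul_same Ha
      rwa [hHa] at this
    exact PosDef.posSemidef_add h1 hHc
  have hNU : IsUnit (Ha * Hc⁻¹ * Ha + Hc).det := (isUnit_iff_isUnit_det _).1 hN.isUnit
  have hZN : (Ha + I • Hc) * (Hc⁻¹ * Ha - I • (1 : Matrix ι ι ℂ)) = Ha * Hc⁻¹ * Ha + Hc := by
    simp only [add_mul, mul_sub, Matrix.mul_smul, Matrix.smul_mul, Matrix.mul_one, smul_smul, Complex.I_mul_I, neg_smul,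
      one_smul, ← Matrix.mul_assoc, mul_nonsing_inv Hc hcU, Matrix.one_mul]
    abel
  rw [← Matrix.mul_assoc, hZN, mul_nonsing_inv _ hNU]

/-- **THE FOURIER–MUKAI IMAGE IN NUMBERS.** For `Z = H_a + iH_c` (`H_a` Hermitian, `H_c` positive definite — the secant exponent `B = a + √-d·b` with
`√d·H_b = H_c > 0` in the dictionary of ATTEMPT-12 §1): `N := H_a H_c⁻¹ H_a + H_c` is positive definite, `Z⁻¹ = (H_c⁻¹ H_a - i)·N⁻¹`, and
`i((-Z⁻¹)ᴴ - (-Z⁻¹)) = 2·N⁻¹`, i.e. **`Im(-Z⁻¹) = (H_c + H_a H_c⁻¹ H_a)⁻¹`** — the transformed secant direction is the explicit positive definite form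
`√d·H_{b'} = (√d H_b + H_a (√d H_b)⁻¹ H_a)⁻¹` (for `a = 0`: `H_{b'} = (d·H_b)⁻¹`, the dual polarisation). [cite: Mukai1981, Thm. 2.2 and Thm. 3.13] [cite: Satake1980AlgebraicStructures, Appendix §3 (I_{p,q}) eq. (3.19)] -/
theorem posDef_im_neg_inv_formula {Ha Hc : Matrix ι ι ℂ} (hHa : Haᴴ = Ha) (hHc : Hc.PosDef) :
    (Ha * Hc⁻¹ * Ha + Hc).PosDef ∧
      (Ha + I • Hc)⁻¹ = (Hc⁻¹ * Ha - I • (1 : Matrix ι ι ℂ)) * (Ha * Hc⁻¹ * Ha + Hc)⁻¹ ∧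
      I • ((-(Ha + I • Hc)⁻¹)ᴴ - (-(Ha + I • Hc)⁻¹)) = (2 : ℂ) • (Ha * Hc⁻¹ * Ha + Hc)⁻¹ := by
  have hcU : IsUnit Hc.det := (isUnit_iff_isUnit_det Hc).1 hHc.isUnit
  have hHcH : Hcᴴ = Hc := hHc.isHermitian
  have hN : (Ha * Hc⁻¹ * Ha + Hc).PosDef := by
    have h1 : (Ha * Hc⁻¹ * Ha).PosSemidef := by
      have := hHc.inv.posSemidef.conjTranspose_mul_mul_same Ha
      rwa [hHa] at this
    exact PosDef.posSemidef_add h1 hHc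
  set N := Ha * Hc⁻¹ * Ha + Hc with hNdef
  have hNU : IsUnit N.det := (isUnit_iff_isUnit_det _).1 hN.isUnit
  have hNH : Nᴴ = N := hN.isHermitian
  have hinv : (Ha + I • Hc)⁻¹ = (Hc⁻¹ * Ha - I • (1 : Matrix ι ι ℂ)) * N⁻¹ :=
    inv_eq_right_inv (add_I_smul_mul_inv_formula_eq_one hHa hHc)
  refine ⟨hN, hinv, ?_⟩
  -- `K := Hc⁻¹ Ha N⁻¹` is Hermitian
  have hcinvH : (Hc⁻¹)ᴴ = Hc⁻¹ := by rw [conjTranspose_nonsing_inv, hHcH]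
  have hNinvH : (N⁻¹)ᴴ = N⁻¹ := by rw [conjTranspose_nonsing_inv, hNH]
  have hcomm : N * (Hc⁻¹ * Ha) = Ha * Hc⁻¹ * N := by
    rw [hNdef, add_mul, mul_add]
    simp only [Matrix.mul_assoc, nonsing_inv_mul Hc hcU, Matrix.mul_one]
    rw [← Matrix.mul_assoc Hc Hc⁻¹ Ha, mul_nonsing_inv Hc hcU, Matrix.one_mul]
  have h2 : Hc⁻¹ * Ha * N⁻¹ = N⁻¹ * (Ha * Hc⁻¹) := by
    calc Hc⁻¹ * Ha * N⁻¹ = N⁻¹ * (N * (Hc⁻¹ * Ha)) * N⁻¹ := by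
          rw [← Matrix.mul_assoc N⁻¹, nonsing_inv_mul N hNU, Matrix.one_mul]
      _ = N⁻¹ * (Ha * Hc⁻¹ * N) * N⁻¹ := by rw [hcomm]
      _ = N⁻¹ * (Ha * Hc⁻¹) := by
          rw [Matrix.mul_assoc, Matrix.mul_assoc (Ha * Hc⁻¹), mul_nonsing_inv N hNU, Matrix.mul_one]
  have hK : (Hc⁻¹ * Ha * N⁻¹)ᴴ = Hc⁻¹ * Ha * N⁻¹ := by
    rw [conjTranspose_mul, conjTranspose_mul, hNinvH, hHa, hcinvH, h2]
  rw [hinv, sub_mul, Matrix.smul_mul, Matrix.one_mul, conjTranspose_neg, conjTranspose_sub, conjTranspose_smul, hK, hNinvH,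
    Complex.star_def, Complex.conj_I]
  have h3 : -(Hc⁻¹ * Ha * N⁻¹ - (-I) • N⁻¹) - -(Hc⁻¹ * Ha * N⁻¹ - I • N⁻¹) = -((2 : ℂ) • (I • N⁻¹)) := by
    rw [neg_smul, two_smul]
    abel
  rw [h3, smul_neg, smul_smul, smul_smul, show I * 2 * I = -2 by rw [mul_comm I 2, mul_assoc, Complex.I_mul_I]; norm_num,
    neg_smul, neg_neg]

end SecantParity

end Summit.Ventures.HSemireg
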